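import Summits.ResolutionOfSingularities.ResolutionOfSingularities.Theorems.HomologicalConductorNoZenoBirthDefs
import Summits.ResolutionOfSingularities.ResolutionOfSingularities.Theorems.NoZeno.Negative.NoZenoValuativeSkeleton
import Summits.ResolutionOfSingularities.ResolutionOfSingularities.Theorems.SyzygyFlatteningHigherRankTerminationTowerStageBasic
import HarnessLib

/-!
# Crux `NoZeno` (stmt-ResolutionOfSingularities-16483), line `birth` — stub `stub_noetherianCase`

Route `ResolutionOfSingularities/HomologicalConductor`, crux
`Summit.ResolutionOfSingularities.ResolutionOfSingularities.Theses.HomologicalConductor.NoZeno`.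
Registered stub 1 of the line `birth` (`Cruxes/NoZeno/Lines/birth.lean`, v1 and v2):

  `StrictDrop` alone forces termination of the canonical normalised `ca`-tower along every
  NOETHERIAN valuation ring `O` (a field or a DVR).

Proof (found by the crux's disprover, `Cruxes/NoZeno/Disproof.lean` F3,
refuter-cdisprove-stmt-ResolutionOfSingularities-16483-0; landed here by the lead over the named
vocabulary of `Theorems/HomologicalConductorNoZenoBirthDefs.lean`):

* `mem_valuationSubring_of_mem_tower` — every stage `T_m` lies in `O` (induction over the `Nat.rec`: `loc` adjoins
  `a * s⁻¹` with `s⁻¹ ∈ O` and `nrm` adjoins elements integral over a subring of the integrally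
  closed `O` — both verbatim the tree lemmas for `SyzygyFlattening.locAt` / `SyzygyFlattening.nrm`,
  which ARE `loc` / `nrm` (`loc_eq_locAt`, `nrm_eq_nrm`, `rfl`); `chart` adjoins `c * x⁻¹ ∈ O` by
  its own admissibility clause; `k ⊆ O`);
* the landed order skeleton `noZenoSkeleton_of_isNoetherianRing` (p152845) with
  `Bad m := ¬ IsRegularLocalRing (T_m)` and `c m := ca (T_m) ⊆ T_m ⊆ O`: were every stage bad,
  `StrictDrop` would give a strictly ascending chain of principal ideals of the noetherian `O`.

`Persistence` is not used; `A.FG` and `IsFractionRing` only feed `StrictDrop`.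
-/

noncomputable section

-- single-problem summit: the doubled namespace component `ResolutionOfSingularities` is forced
set_option linter.dupNamespace false

namespace Summit.ResolutionOfSingularities.ResolutionOfSingularities.Theorems.NoZeno.Birth

open Summit.ResolutionOfSingularities.ResolutionOfSingularities.Theses.HomologicalConductor
open Summit.ResolutionOfSingularities.ResolutionOfSingularities.Theorems.NoZeno.Negative

variable {k K : Type} [Field k] [Field K] [Algebra k K]

/-! ## Every stage of the tower lies in `O` -/

/-- **Every stage of the canonical tower lies in `O`**: `x ∈ T_m → x ∈ O` for all `m` (uses
only `k ⊆ O` and `A ⊆ O`). Induction over the `Nat.rec`: `loc` and `nrm` are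
`SyzygyFlattening.locAt` / `SyzygyFlattening.nrm` (identical bodies, `loc_eq_locAt` /
`nrm_eq_nrm`), whose tree lemmas `locAt_toSubring_le` / `nrm_toSubring_le` apply; a new generator
`c * x⁻¹` of `chart O B` (`c ∈ ca B`, `x` admissible) lies in `O` by the admissibility clause
`∀ c' ∈ ca B, c' * x⁻¹ ∈ O` applied to `c' = c`. [folklore] -/
theorem mem_valuationSubring_of_mem_tower (O : ValuationSubring K) {A : Subalgebra k K}
    (hk : ∀ c : k, algebraMap k K c ∈ O) (hAO : A.toSubring ≤ O.toSubring) :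
    ∀ (m : ℕ) (x : K), x ∈ tower O A m → x ∈ O := by
  intro m
  induction m with
  | zero => exact fun x hx => SyzygyFlattening.locAt_toSubring_le O hk hAO hx
  | succ n ih =>
    rw [tower_succ]
    have hT : (tower O A n).toSubring ≤ O.toSubring := fun x hx => ih x hx
    have hchart : (chart O (tower O A n)).toSubring ≤ O.toSubring := by
      refine SyzygyFlattening.adjoin_toSubring_le_valuationSubring O hk ?_
      rintro y (hy | ⟨c, hc, x, -, -, hadm, rfl⟩)
      · exact hT (Subalgebra.mem_toSubring.mpr hy)
      · exact hadm c hc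
    exact fun x hx => SyzygyFlattening.locAt_toSubring_le O hk
      (SyzygyFlattening.nrm_toSubring_le O hk hchart) hx

/-- `ca (T_m) ⊆ O`. [folklore] -/
theorem ca_tower_subset_valuationSubring (O : ValuationSubring K) {A : Subalgebra k K}
    (hk : ∀ c : k, algebraMap k K c ∈ O) (hAO : A.toSubring ≤ O.toSubring) (m : ℕ) :
    ca (tower O A m) ⊆ (O : Set K) :=
  fun x hx => mem_valuationSubring_of_mem_tower O hk hAO m x (ca_subset _ hx)

/-! ## The registered stub -/

/-- **STUB `stub_noetherianCase` (line `birth` of crux `NoZeno`).** `StrictDrop` alone forces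
termination of the canonical normalised `ca`-tower along every NOETHERIAN valuation ring `O`
(a field or a DVR): `T_m ⊆ O` (`mem_valuationSubring_of_mem_tower`) plus the landed order skeleton
`noZenoSkeleton_of_isNoetherianRing` with `Bad m := ¬ IsRegularLocalRing (T_m)` and
`c m := ca (T_m)` — the drops of `StrictDrop` would otherwise be a strictly ascending chain of
principal ideals of `O`. `Persistence` is not used. Proof by the crux's disprover
(Cruxes/NoZeno/Disproof.lean F3). [cite: ZariskiSamuel1960, Ch. VI §10] -/
theorem stub_noetherianCase (hD : StrictDrop) (p : ℕ) (hp : p.Prime) (k K : Type) [Field k]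
    [CharP k p] [Field K] [Algebra k K] (O : ValuationSubring K) (A : Subalgebra k K)
    (hk : ∀ c : k, algebraMap k K c ∈ O) (hA : A.FG) (hfr : IsFractionRing ↥A K)
    (hAO : A.toSubring ≤ O.toSubring) (hN : IsNoetherianRing ↥O) :
    ∃ m : ℕ, IsRegularLocalRing ↥(tower O A m) := by
  have hdrop : ∀ m : ℕ, ¬ IsRegularLocalRing ↥(tower O A m) → ∃ m' : ℕ, m < m' ∧
      ∃ y ∈ ca (tower O A m'), y ≠ 0 ∧ ∀ x ∈ ca (tower O A m), x ≠ 0 → y * x⁻¹ ∉ O :=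
    hD p hp k K O A hk hA hfr hAO
  obtain ⟨m, hm⟩ := noZenoSkeleton_of_isNoetherianRing O hN
    (fun m => ¬ IsRegularLocalRing ↥(tower O A m)) (fun m => ca (tower O A m))
    (ca_tower_subset_valuationSubring O hk hAO) hdrop
  exact ⟨m, not_not.mp hm⟩

end Summit.ResolutionOfSingularities.ResolutionOfSingularities.Theorems.NoZeno.Birth

end
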